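import Mathlib.Topology.MetricSpace.HausdorffDimension
import Mathlib.MeasureTheory.Measure.Real
import Literature.Probability.Process.BrownianMotion
import Literature.Probability.RandomPlanarGeometry.ConformalRectangle
import Literature.Probability.RandomPlanarGeometry.Curve
import Literature.Probability.RandomPlanarGeometry.CurveSpace
import Literature.Probability.RandomPlanarGeometry.LoewnerChain
import Literature.Probability.RandomPlanarGeometry.SLE
import Literature.Probability.RandomPlanarGeometry.CardyFunction
import Literature.Probability.RandomPlanarGeometry.PlanarDomains
import Literature.Probability.RandomPlanarGeometry.ConformalMap
import HarnessLib

-- provenance: harness21/H21/H21/Statements/CritPerc/SLE.lean @ d6ac5b2 (interim HEAD d8f2665); M5 mechanical rewrite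
/-!
# Critical percolation: chordal SLE statements (family `crit-perc`, S19–S21)

Target statements about chordal Schramm–Loewner evolution built on the `Stoch` prelude
(`Literature.Prelude.Stoch.SLE`, `Literature.Prelude.Stoch.LoewnerChain`):

* **crit-perc.S19** (definition role, recorded as theorems about the prelude definitions,
  consuming the prelude's named facts as hypotheses where needed): chordal SLE_κ in a Dobrushin
  domain is a well-defined law (`existsUnique_isSLELaw'`, from `exists_isSLECurve` and
  `IsSLECurve.map_eq`), the SLE
  hull is the Loewner hull of `t ↦ √κ Bₜ` (`sleHull_eq`, `rfl`), and the SLE map `gₜ(z)` solves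
  the Loewner equation `∂ₜ gₜ(z) = 2 / (gₜ(z) - √κ Bₜ)` before the swallowing time (`sleMap_spec`).
* **crit-perc.S20** (Rohde–Schramm phases, Beffara's dimension): `hasSLETrace_of_ne_eight'`
  (theorem consuming the prelude fact `hasSLETrace_of_ne_eight`),
  `ae_isSimpleTrace_sleTrace_of_le_four`, `ae_isSelfTouching_sleTrace`,
  `ae_isSpaceFilling_sleTrace_of_eight_le`, `ae_dimH_range_sleTrace`; the self-touching phase
  is decomposed (section `SelfTouching` at the end of the file) into the named facts
  `ae_isSwallowed_sleTrace` (Rohde–Schramm Thm 6.4, as printed) and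
  `ae_not_injective_sleTrace` (Rohde–Schramm §1), with the proved reductions
  `ae_interior_range_sleTrace_eq_empty` and `ae_isSelfTouching_sleTrace_of`.
* **crit-perc.S21** (Cardy's formula for SLE₆ and the locality characterisation of `κ = 6`):
  `sle_six_measureReal_hitsBefore`, `eq_six_of_forall_measureReal_hitsBefore`.

Mathlib already provides, and we use: `UpperHalfPlane.upperHalfPlaneSet` (the open upper
half-plane `{z | 0 < z.im}` as a subset of `ℂ`, never redefined here), `dimH` (Hausdorff
dimension, `Mathlib.Topology.MetricSpace.HausdorffDimension`), `MeasureTheory.Measure.real`,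
`HasDerivWithinAt`. Mathlib has no Loewner chains, SLE or Cardy's formula (searched `Loewner`,
`SLE`, `Cardy`).

Design choices.
* `sleMap_spec` is stated for **every** sample path `ω` (not only almost surely): the paths of
  `Literature.Probability.Process.brownian` are continuous by construction (`Literature.Probability.RandomPlanarGeometry.continuous_sleDriving`), so the deterministic
  Loewner theory applies pathwise. Time is `ℝ≥0` in the prelude; the derivative is taken for the
  real-variable function `s ↦ sleMap κ ω s.toNNReal z` within `Set.Ici 0`.
* "Self-touching" (phase `4 < κ < 8`) is the prelude encoding `Loewner.IsSelfTouching γ :=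
  ¬ Injective γ ∧ interior (range γ) = ∅` (architect review 12c).
* **Reading of S21.** The inventory text "SLE₆ in the triangle from `a` to `b` hits `[c, a]` first
  at a point of `[c, d]`", read literally with the chordal target `b`, is an ill-posed /
  probability-zero event. We state the standard crossing form (Werner 2007 §3, Smirnov 2001,
  Lawler–Schramm–Werner 2001): chordal SLE₆ from `a = R.pt 0` to `c = R.pt 2` in the conformal
  rectangle `(Ω; a, b, c, d)` hits the arc `(cd) = R.arc 2` before the arc `(bc) = R.arc 1` with
  probability `F(η)`, `η = crossRatio x` for any uniformizing datum `(φ, x)` of `R`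
  (independent of the datum by `ConformalRectangle.crossRatio_eq_of_isUniformizing`).

References: O. Schramm, Israel J. Math. 118 (2000); S. Rohde, O. Schramm, *Basic properties of
SLE*, Ann. Math. 161 (2005), §1, Thms 5.1, 6.1, 6.4, Cor. 7.4; V. Beffara, *The dimension of the SLE curves*,
Ann. Probab. 36 (2008); G. Lawler, O. Schramm, W. Werner, *Values of Brownian intersection
exponents I*, Acta Math. 187 (2001), §3, and Ann. Probab. 32 (2004); S. Smirnov, C. R. Acad.
Sci. 333 (2001); W. Werner, *Lectures on two-dimensional critical percolation* (2007), §3;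
G. Lawler, *Conformally invariant processes in the plane*, AMS (2005), Ch. 6.
-/

noncomputable section

open Set Filter Topology MeasureTheory ProbabilityTheory
open UpperHalfPlane (upperHalfPlaneSet isOpen_upperHalfPlaneSet)
open scoped NNReal ENNReal unitInterval

namespace Literature.Probability.RandomPlanarGeometry

section CritPerc

/-! ### crit-perc.S19: chordal SLE_κ (definition role) -/

section Definition

variable (κ : ℝ≥0)

/-- **crit-perc.S19** (chordal SLE_κ in `(Ω; a, b)` as the conformal image; Schramm, Israel J.
Math. 118 (2000), §1; Lawler (2005), Ch. 6, §6.3). For `κ > 0` and a Dobrushin domain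
`D = (Ω; a, b)` there is exactly one probability measure on curves modulo reparametrisation which
is the law of chordal SLE_κ in `D` from `a` to `b` (`Literature.Probability.RandomPlanarGeometry.IsSLELaw`), i.e. of the
time-compactified image of the SLE_κ trace in `(ℍ; 0, ∞)` under a chordal uniformizing map.
Theorem consuming the prelude facts `Literature.Probability.RandomPlanarGeometry.exists_isSLECurve` (existence of the SLE trace and its
conformal transport, hypothesis `hex`) and `Literature.Probability.RandomPlanarGeometry.IsSLECurve.map_eq` (hypothesis `huniq`), via
`Literature.Probability.RandomPlanarGeometry.existsUnique_isSLELaw`. [cite: Lawler2005, §6.3] -/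
theorem existsUnique_isSLELaw' (hex : exists_isSLECurve) (huniq : IsSLECurve.map_eq) (hκ : 0 < κ)
    (D : DobrushinDomain) : ∃! μ : Measure (CurveClass ℂ), IsSLELaw κ D μ :=
  existsUnique_isSLELaw hex huniq hκ D

/-- **crit-perc.S19** (the SLE_κ hulls `Kₜ`; Schramm (2000), §1; Rohde–Schramm, Ann. Math. 161
(2005), §1; Lawler (2005), Def. 6.1). Sanity restatement: the SLE_κ hull at time `t` is the
Loewner hull of the driving function `s ↦ √κ B_s(ω)`, `B = Literature.brownian` the canonical Brownian
motion on `(ℝ≥0 → ℝ, preWienerMeasure)`. [cite: Schramm2000] -/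
theorem sleHull_eq (ω : ℝ≥0 → ℝ) (t : ℝ≥0) :
    sleHull κ ω t = Loewner.hull (fun s ↦ Real.sqrt κ * Process.brownian s ω) t := rfl

/-- **crit-perc.S19** (the chordal Loewner equation `∂ₜ gₜ(z) = 2 / (gₜ(z) - √κ Bₜ)`,
`g₀(z) = z`; Schramm (2000), §1; Lawler (2005), Ch. 4, §4.1 and Def. 6.1). For every sample path
`ω`, every `z` in the open upper half-plane and every time `t` before the swallowing time `T_z`,
the SLE_κ map `s ↦ g_s(z) = sleMap κ ω s z` has derivative `2 / (gₜ(z) - √κ Bₜ(ω))` at `t`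
(from the right at `t = 0`), and `g₀(z) = z`. Restated from the characterisation of
`Literature.Probability.RandomPlanarGeometry.Loewner.map` as the value of the (unique) solution of the Loewner ODE
(`Loewner.exists_isSolution_swallowingTime`, `Loewner.IsSolution.eqOn`); holds pathwise since
`sleDriving κ ω` is continuous for every `ω`. [cite: Schramm2000] -/
def sleMap_spec : Prop :=
  ∀ (ω : ℝ≥0 → ℝ) {z : ℂ}, z ∈ upperHalfPlaneSet → ∀ {t : ℝ≥0},
    (t : WithTop ℝ≥0) < Loewner.swallowingTime (sleDriving κ ω) z →
    HasDerivWithinAt (fun s : ℝ ↦ sleMap κ ω s.toNNReal z)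
      (2 / (sleMap κ ω t z - sleDriving κ ω t)) (Ici 0) t ∧ sleMap κ ω 0 z = z

end Definition

/-! ### crit-perc.S20: Rohde–Schramm phases of the SLE trace -/

section Phases

variable {κ : ℝ≥0}

/-- **crit-perc.S20** (Rohde–Schramm theorem; Rohde–Schramm, Ann. Math. 161 (2005), Thm 5.1).
For `κ ≠ 8`, chordal SLE_κ is almost surely generated by a continuous curve `γ`
(`Kₜ` is the complement of the unbounded component of `ℍ \ γ[0, t]`). Restates
the prelude fact `Literature.Probability.RandomPlanarGeometry.hasSLETrace_of_ne_eight` (the Rohde–Schramm theorem, vendored there):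
a theorem consuming that fact (hypothesis `h`). [cite: RohdeSchramm2005, Thm 5.1] -/
theorem hasSLETrace_of_ne_eight' (h : hasSLETrace_of_ne_eight) (hκ : κ ≠ 8) : HasSLETrace κ :=
  h hκ

/-- **crit-perc.S20** (simple phase; Rohde–Schramm, Ann. Math. 161 (2005), Thm 6.1). For
`0 < κ ≤ 4` the SLE_κ trace is almost surely a simple curve staying in the open upper half-plane
for positive times (`Loewner.IsSimpleTrace`). [cite: RohdeSchramm2005, Thm 6.1] -/
def ae_isSimpleTrace_sleTrace_of_le_four : Prop :=
  0 < κ → κ ≤ 4 → ∀ᵐ ω ∂Process.preWienerMeasure, Loewner.IsSimpleTrace (sleTrace κ ω)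

/-- **crit-perc.S20** (self-touching phase; Rohde–Schramm, Ann. Math. 161 (2005), §1 (p. 885:
"for `κ ∈ (4, 8)` the path `γ` is not a simple path and for every `z ∈ closure ℍ` a.s.
`z ∉ γ[0, ∞)` but `z ∈ ⋃ₜ Kₜ`") and Thm 6.4 (every `z ∈ closure ℍ ∖ {0}` is a.s. swallowed);
in the published numbering Thm 6.1 is the simple phase `κ ≤ 4`). For `4 < κ < 8` the SLE_κ
trace is almost surely self-touching, encoded as
`Loewner.IsSelfTouching γ := ¬ Function.Injective γ ∧ interior (Set.range γ) = ∅` (the trace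
hits itself or the real line, but is not space-filling). In particular SLE₆ is not simple.
Reduced to the named facts `ae_not_injective_sleTrace` (§1) and `ae_isSwallowed_sleTrace`
(Thm 6.4) by `ae_isSelfTouching_sleTrace_of` below. [cite: RohdeSchramm2005, §1 p. 885 and Thm 6.4] -/
def ae_isSelfTouching_sleTrace : Prop :=
  4 < κ ∧ κ < 8 → ∀ᵐ ω ∂Process.preWienerMeasure, Loewner.IsSelfTouching (sleTrace κ ω)

/-- **crit-perc.S20** (space-filling phase; Rohde–Schramm, Ann. Math. 161 (2005), Cor. 7.4
("Suppose that `κ > 8`, then `γ[0, ∞) = closure ℍ` a.s.") and its Update for `κ = 8`, based on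
Lawler–Schramm–Werner, Ann. Probab. 32 (2004)). For `κ ≥ 8` the SLE_κ trace is
almost surely space-filling: its range is the closed upper half-plane
(`Loewner.IsSpaceFilling`). [cite: RohdeSchramm2005, Cor. 7.4] -/
def ae_isSpaceFilling_sleTrace_of_eight_le : Prop :=
  8 ≤ κ → ∀ᵐ ω ∂Process.preWienerMeasure, Loewner.IsSpaceFilling (sleTrace κ ω)

/-- **crit-perc.S20** (dimension of the SLE trace; Beffara, *The dimension of the SLE curves*,
Ann. Probab. 36 (2008), Thm 1; upper bound Rohde–Schramm (2005), Thm 8.1). For `0 < κ ≤ 8` the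
Hausdorff dimension of the range of the SLE_κ trace is almost surely `1 + κ / 8`; for `κ = 6`
this is `7 / 4`. [cite: Beffara2008, Thm 1] -/
def ae_dimH_range_sleTrace : Prop :=
  0 < κ → κ ≤ 8 →
    ∀ᵐ ω ∂Process.preWienerMeasure, dimH (range (sleTrace κ ω)) = 1 + (κ : ℝ≥0∞) / 8

end Phases

/-! ### crit-perc.S21: Cardy's formula for SLE₆ and locality -/

section Cardy

/-- **crit-perc.S21** (Cardy's formula for SLE₆; Lawler–Schramm–Werner, Acta Math. 187 (2001),
§3; Smirnov, C. R. Acad. Sci. 333 (2001); Werner (2007), §3). Let `R = (Ω; a, b, c, d)` be a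
conformal rectangle and `μ` the law of chordal SLE₆ in `(Ω; a, c)` (`R.chord 0 2`, from
`a = R.pt 0` to `c = R.pt 2`). Then the probability that the SLE₆ curve hits the boundary arc
`(cd) = R.arc 2` before the arc `(bc) = R.arc 1` equals Cardy's function `F(η)` of the
cross-ratio `η = crossRatio x` of any uniformizing datum `(φ, x)` of `R`; for the equilateral
triangle with `d ∈ [c, a]` this is `|d - c| / |a - c|`. **Reading**: the inventory's "hits
`[c, a]` first at a point of `[c, d]`" with target `b` is, read literally for a chordal curve
ending at its target, ill posed (probability `0`); we state the standard crossing form above.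
The event is measurable by `CurveClass.measurableSet_hitsBefore` and `MarkedDomain.isClosed_arc`;
`μ` is a probability measure by `IsSLELaw.isProbabilityMeasure`. [cite: Werner2007] -/
def sle_six_measureReal_hitsBefore : Prop :=
  ∀ (R : ConformalRectangle) {μ : Measure (CurveClass ℂ)} (hμ : IsSLELaw 6 (R.chord 0 2 (by decide)) μ) {φ : ConformalEquiv upperHalfPlaneSet R.carrier} {x : Fin 4 → ℝ} (hφ : R.IsUniformizing φ x),
    μ.real (CurveClass.hitsBefore (R.arc 2) (R.arc 1)) = cardyFunction (crossRatio x)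

/-- **crit-perc.S21** (`κ = 6` is the unique locality parameter; Lawler–Schramm–Werner, Acta
Math. 187 (2001), §3; Schramm, Israel J. Math. 118 (2000); Werner (2007), §3). If `κ > 0` is
such that chordal SLE_κ satisfies Cardy's crossing formula in every conformal rectangle — the
SLE_κ curve from `a` to `c` in `(Ω; a, b, c, d)` hits `(cd)` before `(bc)` with probability
`F(η)` — then `κ = 6`. (Cardy's formula in all rectangles expresses the locality property, and
the drift computation of LSW 2001 §3 singles out `κ = 6`.) [cite: Werner2007] -/
def eq_six_of_forall_measureReal_hitsBefore : Prop :=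
  ∀ {κ : ℝ≥0} (hκ : 0 < κ) (h : ∀ (R : ConformalRectangle) (μ : Measure (CurveClass ℂ)) (φ : ConformalEquiv upperHalfPlaneSet R.carrier) (x : Fin 4 → ℝ), IsSLELaw κ (R.chord 0 2 (by decide)) μ → R.IsUniformizing φ x → μ.real (CurveClass.hitsBefore (R.arc 2) (R.arc 1)) = cardyFunction (crossRatio x)),
    κ = 6

end Cardy

/-! ### crit-perc.S20, self-touching phase `4 < κ < 8`: decomposition and reduction

`ae_isSelfTouching_sleTrace` (almost surely `¬ Injective γ ∧ interior (range γ) = ∅`) is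
reduced to two named facts vendored from Rohde–Schramm (2005) as printed there:
`ae_not_injective_sleTrace` (§1, p. 885: "for `κ ∈ (4, 8)` the path `γ` is not a simple
path") and `ae_isSwallowed_sleTrace` (Thm 6.4: for `κ ∈ (4, 8)` every `z ∈ closure ℍ ∖ {0}` is
a.s. swallowed, in particular a.s. not on the trace). The second conjunct follows from Thm 6.4
alone (`ae_interior_range_sleTrace_eq_empty`, proved): almost surely no point `q₁ + i q₂`
(`q₁, q₂ ∈ ℚ`, `q₂ > 0`) lies on the trace (countably many null events), while the trace lies
in the closed upper half-plane for every sample path (`sleTrace_im_nonneg`), so a disc inside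
its range would contain such a point. The remaining inputs for a full discharge are the two
named facts themselves (Rohde–Schramm §§3–6: trace existence Thm 5.1, the Bessel/martingale
computations of Lemmas 6.3, 6.5, 6.6, and the Markov property Prop. 2.1). -/

section SelfTouching

variable {κ : ℝ≥0}

/-- **Rohde–Schramm, Thm 6.4** (first half, as printed): "If `κ ∈ (4, 8)` and
`z ∈ closure ℍ ∖ {0}`, then a.s. `z` is swallowed", where (p. 906) "we say that `z ∈ closure ℍ`
is swallowed by the SLE if `z ∉ γ[0, ∞)` but `z ∈ Kₜ` for some `t ∈ (0, ∞)`"; with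
`Kₜ = {z ∈ closure ℍ : τ(z) ≤ t}` (§2.1) the second clause is `τ(z) < ∞`. In prelude terms, for
`z : ℂ` with `0 ≤ im z`, `z ≠ 0`: almost surely `z` is not in the range of the SLE_κ trace
`sleTrace κ ω` and its swallowing time `Loewner.swallowingTime (sleDriving κ ω) z` (the
lifetime of the Loewner flow (2.1) started at `z`) is finite. The second half of Thm 6.4 (for
`κ ∉ (4, 8)` a.s. no `z ≠ 0` is swallowed) is not vendored here.
[cite: RohdeSchramm2005, Thm 6.4] -/
def ae_isSwallowed_sleTrace : Prop :=
  ∀ {κ : ℝ≥0}, 4 < κ → κ < 8 → ∀ {z : ℂ}, 0 ≤ z.im → z ≠ 0 →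
    ∀ᵐ ω ∂Process.preWienerMeasure,
      z ∉ range (sleTrace κ ω) ∧ Loewner.swallowingTime (sleDriving κ ω) z < ⊤

/-- **Rohde–Schramm, §1** (p. 885; abstract: "for `κ ∈ (4, 8)` it is a self-intersecting
path"; p. 886: "the trace is a.s. a simple path if and only if `κ ∈ [0, 4]`"). "For `κ ∈ (4, 8)`
the path `γ` is not a simple path": almost surely the SLE_κ trace is not injective. Rohde and
Schramm record this in the summary of results of §1 as part of the phase picture of §6
(Thm 6.4), recalling (p. 901) that Schramm (2000) proved that for `κ > 4` a.s. `Kₜ` is not a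
simple path. [cite: RohdeSchramm2005, §1 p. 885] -/
def ae_not_injective_sleTrace : Prop :=
  ∀ {κ : ℝ≥0}, 4 < κ → κ < 8 →
    ∀ᵐ ω ∂Process.preWienerMeasure, ¬ Function.Injective (sleTrace κ ω)

/-- The SLE_κ trace lies in the closed upper half-plane for **every** sample path: a generating
curve does by definition (`Loewner.IsGeneratedByCurve.im_nonneg`), and the junk constant curve
`W 0` of `Loewner.trace` is real. [folklore] -/
theorem sleTrace_im_nonneg (κ : ℝ≥0) (ω : ℝ≥0 → ℝ) (t : ℝ≥0) : 0 ≤ (sleTrace κ ω t).im := by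
  by_cases h : ∃ γ, Loewner.IsGeneratedByCurve (sleDriving κ ω) γ
  · exact (Loewner.isGeneratedByCurve_trace h).im_nonneg t
  · rw [sleTrace, Loewner.trace, dif_neg h]
    simp

/-- **The SLE_κ trace, `4 < κ < 8`, a.s. has range with empty interior** (second conjunct of
`Loewner.IsSelfTouching`), from Rohde–Schramm Thm 6.4 (hypothesis `h`, the named fact
`ae_isSwallowed_sleTrace`): by countable additivity, almost surely none of the countably many
points `q₁ + i q₂`, `q₁, q₂ ∈ ℚ`, `q₂ > 0`, is on the trace; the trace lies in the closed upper
half-plane (`sleTrace_im_nonneg`), so a disc `ball w r ⊆ range γ` (necessarily `im w ≥ 0`)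
would contain the point `q₁ + i q₂` with `|q₁ - re w| < r/4`, `im w + r/4 < q₂ < im w + r/2`.
Rohde–Schramm, §1 p. 885 ("for every `z ∈ closure ℍ` a.s. `z ∉ γ[0, ∞)`", whence `γ[0, ∞)`
is not all of `closure ℍ`). [cite: RohdeSchramm2005, Thm 6.4] -/
theorem ae_interior_range_sleTrace_eq_empty (h : ae_isSwallowed_sleTrace) (hκ : 4 < κ)
    (hκ' : κ < 8) : ∀ᵐ ω ∂Process.preWienerMeasure, interior (range (sleTrace κ ω)) = ∅ := by
  -- a.s. no rational point of the open upper half-plane is on the trace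
  have hq : ∀ᵐ ω ∂Process.preWienerMeasure, ∀ p : {p : ℚ × ℚ // 0 < p.2},
      (⟨(p.1.1 : ℝ), (p.1.2 : ℝ)⟩ : ℂ) ∉ range (sleTrace κ ω) := by
    refine ae_all_iff.2 ?_
    rintro ⟨⟨q₁, q₂⟩, hq₂⟩
    have hq₂' : (0 : ℝ) < q₂ := by exact_mod_cast hq₂
    have hz : (0 : ℝ) ≤ (⟨(q₁ : ℝ), (q₂ : ℝ)⟩ : ℂ).im := hq₂'.le
    have hz0 : (⟨(q₁ : ℝ), (q₂ : ℝ)⟩ : ℂ) ≠ 0 := by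
      intro h0
      have him : (q₂ : ℝ) = 0 := by simpa using congrArg Complex.im h0
      exact hq₂'.ne' him
    exact (h hκ hκ' hz hz0).mono fun ω hω ↦ hω.1
  filter_upwards [hq] with ω hω
  rw [Set.eq_empty_iff_forall_notMem]
  intro w hw
  rw [mem_interior_iff_mem_nhds, Metric.mem_nhds_iff] at hw
  obtain ⟨r, hr, hball⟩ := hw
  -- the centre of the disc is on the trace, hence in the closed upper half-plane
  have hw0 : 0 ≤ w.im := by
    obtain ⟨t, ht⟩ := hball (Metric.mem_ball_self hr)
    exact ht ▸ sleTrace_im_nonneg κ ω t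
  obtain ⟨q₁, hq₁, hq₁'⟩ := exists_rat_btwn (show w.re - r / 4 < w.re + r / 4 by linarith)
  obtain ⟨q₂, hq₂, hq₂'⟩ := exists_rat_btwn (show w.im + r / 4 < w.im + r / 2 by linarith)
  have hq₂pos : (0 : ℚ) < q₂ := by exact_mod_cast (show (0 : ℝ) < q₂ by linarith)
  refine hω ⟨(q₁, q₂), hq₂pos⟩ (hball ?_)
  show (⟨(q₁ : ℝ), (q₂ : ℝ)⟩ : ℂ) ∈ Metric.ball w r
  rw [Metric.mem_ball, dist_eq_norm]
  refine (Complex.norm_le_abs_re_add_abs_im _).trans_lt ?_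
  have h₁ : |(q₁ : ℝ) - w.re| < r / 4 := abs_lt.2 ⟨by linarith, by linarith⟩
  have h₂ : |(q₂ : ℝ) - w.im| < r / 2 := abs_lt.2 ⟨by linarith, by linarith⟩
  simp only [Complex.sub_re, Complex.sub_im]
  linarith

/-- **Reduction of the self-touching phase** `ae_isSelfTouching_sleTrace` to the two named facts
`ae_not_injective_sleTrace` (Rohde–Schramm §1, hypothesis `hA`) and `ae_isSwallowed_sleTrace`
(Rohde–Schramm Thm 6.4, hypothesis `h64`, through `ae_interior_range_sleTrace_eq_empty`).
[cite: RohdeSchramm2005, §1 p. 885 and Thm 6.4] -/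
theorem ae_isSelfTouching_sleTrace_of (hA : ae_not_injective_sleTrace)
    (h64 : ae_isSwallowed_sleTrace) : ae_isSelfTouching_sleTrace (κ := κ) := by
  rintro ⟨hκ, hκ'⟩
  filter_upwards [hA hκ hκ', ae_interior_range_sleTrace_eq_empty h64 hκ hκ'] with ω h₁ h₂
  exact ⟨h₁, h₂⟩

end SelfTouching

end CritPerc

end Literature.Probability.RandomPlanarGeometry
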